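import Summits.Ventures.Crystal3D.Theorems.StickyWulffConstantPolycrystalWulffBoundInclinedLamellarSections
import Summits.Ventures.Crystal3D.Theorems.StickyWulffConstantPolycrystalWulffBoundMinkowskiUpper
import Summits.Ventures.Crystal3D.Theorems.StickyWulffConstantTextureLiminfTexShadowCertificateDefs
import Literature.Analysis.Convexity.AnisotropicPerimeterPolytopeUnionPatchesLocal
import Literature.Analysis.Convexity.AnisotropicPerimeterPolytopePrism
import Literature.Analysis.Convexity.OpenHPolytopeNormalForm
import HarnessLib

/-!
# TB-D assembly, part 3: the (T) sub-ledger — EXPOSED facets of a piece family inside an open set are paid by `perKIn`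
# (lane T, crux `TextureLiminfV5`, stmt-Ventures-23912; design memo TB-D-0 §4 (T), §7)

HONEST FRAMING. Venture `Summits/Ventures/Crystal3D` (cell `crystal3d-full`), route `route-Ventures-StickyWulffConstant`, helper `--supports` the
law-v5 crux `TextureLiminfV5` (stmt-Ventures-23912).  Plumbing between the piece ledger's vocabulary (`polytope`, `facetArea`, `supportFn`,
`perKIn`) and lit's localized patch sum for unions of polytopes (`Literature.Analysis.Convexity.patchSumIn_le_anisotropicPerimeterIn_iUnion_cells`,
Maggi 2012 (12.2)–(12.3), (20.2)); census-free, standard axioms; nothing about any cover or mesh; F-C1 not moved.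

THE STATEMENT (`exposedFacetSumIn_le_perKIn`).  For pieces `P μ = polytope (Hp μ)` (bounded, unit facet normals, pairwise distinct facet planes,
pairwise disjoint), an open set `U` and a compact convex body `K ∋ 0`:

  `ofReal (Σ_μ Σ_{p ∈ Hp μ} h_K(p.1) · facetArea (((F μ p ∖ ⋃_{μ'≠μ} cl P μ') ∩ U)) p.1) ≤ perKIn K (⋃_μ P μ) U`,

`F μ p = cl P μ ∩ {⟪p.1,x⟫ = p.2}`: the free term of `energy_le_pieceLedger` (…TextureBuildPieceEnergy), restricted to the facet parts INSIDE `U`,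
is bounded by the perimeter of the union LOCALIZED to `U` — which for the tent pieces of a grain is what `BarlowFreeCertificate` bounds by
half the broken bonds near `U` (`2·Σ_i perKIn (wulffOf (A i)) G (U ∩ laySlab i) ≤ brokenNearIn`).  Steps: lit's open facets differ from the
closed facets `F μ p` by edge sets lying in two planes (`facetArea_eq_zero_of_subset_two_planes`); `facetArea = ` chart area
(`volume_prism_eq_volume_chartPreimage`); empty pieces contribute nothing; `perKIn` IS lit's `anisotropicPerimeterIn`.
-/

noncomputable section

namespace Summit.Ventures.Crystal3D.Cruxes.TextureLiminf.TexShadow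

open Summit.Ventures.Crystal3D Summit.Ventures.Crystal3D.Theorems MeasureTheory Set
open scoped InnerProductSpace
open Literature.Analysis.Convexity (exists_symmetric_frames cell_normalForm openFacet_subset_closedHPolytope
  patchSumIn_le_anisotropicPerimeterIn_iUnion_cells volume_prism_eq_volume_chartPreimage anisotropicPerimeterIn)

/-- **The (T) sub-ledger: exposed facet parts inside an open set `U` are paid by the perimeter localized to `U`.**  See the module docstring. -/
theorem exposedFacetSumIn_le_perKIn {M : ℕ} (Hp : Fin M → Finset (E3 × ℝ))
    (hbd : ∀ μ, Bornology.IsBounded (polytope (Hp μ))) (hunit : ∀ μ, ∀ p ∈ Hp μ, ‖p.1‖ = 1)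
    (hplanes : ∀ μ, ∀ p ∈ Hp μ, ∀ p' ∈ Hp μ, p ≠ p' →
      {x : E3 | ⟪p.1, x⟫_ℝ = p.2} ≠ {x : E3 | ⟪p'.1, x⟫_ℝ = p'.2})
    (hdisj : ∀ μ μ', μ ≠ μ' → Disjoint (polytope (Hp μ)) (polytope (Hp μ')))
    {U : Set E3} (hU : IsOpen U) {K : Set E3} (hK : IsCompact K) (hKc : Convex ℝ K) (hK0 : (0 : E3) ∈ K) :
    ENNReal.ofReal (∑ μ, ∑ p ∈ Hp μ, supportFn K p.1 *
        facetArea ((((closure (polytope (Hp μ)) ∩ {x : E3 | ⟪p.1, x⟫_ℝ = p.2}) \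
          ⋃ μ' ∈ Finset.univ.erase μ, closure (polytope (Hp μ'))) ∩ U)) p.1) ≤
      perKIn K (⋃ μ, polytope (Hp μ)) U := by
  classical
  -- the data of lit's union calculus
  set Q : Fin M → Set E3 := fun μ => polytope (Hp μ) with hQdef
  have hQ : ∀ μ, Q μ = ⋂ p ∈ Hp μ, {x : E3 | ⟪p.1, x⟫_ℝ < p.2} := fun μ => rfl
  set J : Fin M → Finset (E3 × ℝ) := fun μ =>
    ((Hp μ).filter (fun p => p.1 ≠ 0)).image (fun p => (‖p.1‖⁻¹ • p.1, ‖p.1‖⁻¹ * p.2)) with hJdef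
  have hJ : ∀ μ, J μ = ((Hp μ).filter (fun p => p.1 ≠ 0)).image (fun p => (‖p.1‖⁻¹ • p.1, ‖p.1‖⁻¹ * p.2)) :=
    fun μ => rfl
  have hJH : ∀ μ, J μ = Hp μ := by
    intro μ
    rw [hJ, Finset.filter_true_of_mem (fun p hp => by
      intro h0; have h := hunit μ p hp; rw [h0, norm_zero] at h; exact zero_ne_one h)]
    rw [Finset.image_congr (g := id) (fun p hp => by
      have h := hunit μ p (Finset.mem_coe.1 hp)
      simp only [h, inv_one, one_smul, one_mul, id_eq]), Finset.image_id]
  obtain ⟨fU, fV, hfr, hsym⟩ := exists_symmetric_frames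
  set Φ : E3 × ℝ → ℝ × ℝ → E3 := fun c y => c.2 • c.1 + y.1 • fU c.1 + y.2 • fV c.1 with hΦdef
  have hΦ : ∀ c y, Φ c y = c.2 • c.1 + y.1 • fU c.1 + y.2 • fV c.1 := fun c y => rfl
  set oF : Fin M → E3 × ℝ → Set E3 := fun μ c =>
    {x | ⟪c.1, x⟫_ℝ = c.2 ∧ ∀ c' ∈ J μ, c' ≠ c → ⟪c'.1, x⟫_ℝ < c'.2} with hoFdef
  have hoF : ∀ μ c, oF μ c = {x | ⟪c.1, x⟫_ℝ = c.2 ∧ ∀ c' ∈ J μ, c' ≠ c → ⟪c'.1, x⟫_ℝ < c'.2} := fun μ c => rfl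
  set I : Finset (Fin M) := Finset.univ.filter (fun μ => (Q μ).Nonempty) with hIdef
  have hI : ∀ μ, μ ∈ I ↔ (Q μ).Nonempty := fun μ => by simp [hIdef]
  have key := patchSumIn_le_anisotropicPerimeterIn_iUnion_cells Hp Q hQ J hJ fU fV hfr hsym Φ hΦ oF hoF I hI hbd
    hdisj hU hK hKc hK0
  -- compare the two sums termwise
  refine le_trans (ENNReal.ofReal_le_ofReal ?_) key
  rw [Finset.sum_sigma]
  -- empty pieces contribute nothing on the left
  rw [← Finset.sum_subset (Finset.subset_univ I) (fun μ _ hμ => by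
    have hQe : polytope (Hp μ) = ∅ := Set.not_nonempty_iff_eq_empty.1 (fun hne => hμ ((hI μ).2 hne))
    refine Finset.sum_eq_zero fun p _ => ?_
    rw [hQe, closure_empty, Set.empty_inter, Set.empty_sdiff, Set.empty_inter]
    unfold facetArea
    simp)]
  refine Finset.sum_le_sum fun μ hμ => ?_
  rw [hJH μ]
  refine Finset.sum_le_sum fun p hp => ?_
  -- facts about the piece `μ` and the constraint `p`
  obtain ⟨-, -, -, hcli⟩ := cell_normalForm Hp Q hQ J hJ ((hI μ).1 hμ)
  rw [hJH μ] at hcli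
  obtain ⟨hU1, hV1, hUV, haU, haV⟩ := hfr p.1 (hunit μ p hp)
  have hp1 : ⟪p.1, p.1⟫_ℝ = 1 := by rw [real_inner_self_eq_norm_sq, hunit μ p hp, one_pow]
  -- (a) the chart volume is the facet area of the lit patch
  set B : Set E3 := (oF μ p \ ⋃ j ∈ I.erase μ, closure (Q j)) ∩ U with hB
  have hBplane : ∀ y ∈ B, ⟪p.1, y⟫_ℝ = ⟪p.1, p.2 • p.1⟫_ℝ := by
    intro y hy
    rw [real_inner_smul_right, hp1, mul_one]
    exact hy.1.1.1
  have hvolB : (volume (Φ p ⁻¹' B)).toReal = facetArea B p.1 := by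
    unfold facetArea
    rw [volume_prism_eq_volume_chartPreimage (hunit μ p hp) hU1 hV1 hUV haU haV hBplane]
    rfl
  rw [hvolB]
  refine mul_le_mul_of_nonneg_left ?_ ?_
  swap
  · unfold supportFn
    exact Literature.Analysis.Convexity.sSup_inner_image_nonneg hK hK0 _
  -- (b) the closed facet minus the cover is the open patch up to edges
  set E : E3 × ℝ → Set E3 := fun p' =>
    if p' = p then B else closure (polytope (Hp μ)) ∩ {x : E3 | ⟪p.1, x⟫_ℝ = p.2} ∩ {x : E3 | ⟪p'.1, x⟫_ℝ = p'.2}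
    with hE
  have hcov : (((closure (polytope (Hp μ)) ∩ {x : E3 | ⟪p.1, x⟫_ℝ = p.2}) \
      ⋃ μ' ∈ Finset.univ.erase μ, closure (polytope (Hp μ'))) ∩ U) ⊆ ⋃ p' ∈ Hp μ, E p' := by
    rintro x ⟨⟨⟨hxcl, hxp⟩, hxcov⟩, hxU⟩
    by_cases hstrict : ∀ c' ∈ Hp μ, c' ≠ p → ⟪c'.1, x⟫_ℝ < c'.2
    · refine mem_iUnion₂.2 ⟨p, hp, ?_⟩
      rw [hE]; simp only [if_true]
      refine ⟨⟨⟨hxp, fun c' hc' hne => hstrict c' (by rw [← hJH μ]; exact hc') hne⟩, fun hx' => hxcov ?_⟩, hxU⟩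
      obtain ⟨j, hj, hxj⟩ := mem_iUnion₂.1 hx'
      exact mem_iUnion₂.2 ⟨j, Finset.mem_erase.2 ⟨(Finset.mem_erase.1 hj).1, Finset.mem_univ _⟩, hxj⟩
    · push Not at hstrict
      obtain ⟨c', hc', hne, hge⟩ := hstrict
      have hle : ⟪c'.1, x⟫_ℝ ≤ c'.2 := by
        have hx' : x ∈ ⋂ c ∈ Hp μ, {x : E3 | ⟪c.1, x⟫_ℝ ≤ c.2} := by rw [← hcli]; exact hxcl
        simp only [mem_iInter, mem_setOf_eq] at hx'
        exact hx' c' hc'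
      refine mem_iUnion₂.2 ⟨c', hc', ?_⟩
      rw [hE]; simp only [if_neg hne]
      exact ⟨⟨hxcl, hxp⟩, le_antisymm hle hge⟩
  have hfinE : ∀ p' ∈ Hp μ, volume {x : E3 | ∃ y ∈ E p', ∃ t ∈ Set.Icc (0 : ℝ) 1, x = y + t • p.1} ≠ ⊤ := by
    intro p' _
    refine volume_prism_ne_top_of_isBounded (hbd μ) _ (fun y hy => ?_) p.1
    by_cases h : p' = p
    · rw [hE] at hy; simp only [h, if_true] at hy
      have hy' := openFacet_subset_closedHPolytope (J μ) hy.1.1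
      rw [hJH μ, ← hcli] at hy'
      exact hy'
    · rw [hE] at hy; simp only [if_neg h] at hy
      exact hy.1.1
  have hsub := facetArea_le_sum_of_subset_iUnion (Hp μ) _ E p.1 hcov hfinE
  refine hsub.trans (le_of_eq ?_)
  rw [Finset.sum_eq_single_of_mem p hp (fun p' hp' hne => ?_)]
  · rw [hE]; simp only [if_true]
  · rw [hE]; simp only [if_neg hne]
    exact facetArea_eq_zero_of_subset_two_planes (ν := p.1) (β := p.2) (π := p') (hunit μ p hp) (hunit μ p' hp')
      (fun x hx => ⟨hx.1.2, hx.2⟩) (hplanes μ p hp p' hp' (Ne.symm hne))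

end Summit.Ventures.Crystal3D.Cruxes.TextureLiminf.TexShadow

end
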